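import Summits.Ventures.LatticeQCDFlow.TrivializingMaps.AbelianContraction

/-!
HONEST FRAMING: exact (Metropolis-corrected) sampling algorithms for lattice gauge theory; figures of
merit are autocorrelation/cost numbers at stated couplings and volumes; no continuum-physics claim.

# AbelianGeometricBound — PROOF of `abelianGeometricGradientBound : AbelianGeometricGradientBound K`
(THEORY-1.md §12.4, U(1) line of THEOREM A): `N_e(a^{(k)}) ≤ (D/4)(3D)^k` for every finite plaquette complex
with the girth-4 property, and UNCONDITIONALLY `N_e(a^{(k)}) ≤ (D/4)(9D)^k` (`abelianGeometricGradientBound_one`)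
— a convergence radius `tβ ≥ 1/(3D)` (resp. `1/(9D)`) for the gradient series that does NOT depend on the size
of the complex

Proposed tree path: `Summits/Ventures/LatticeQCDFlow/TrivializingMaps/AbelianGeometricBound.lean` (OURS). Imports
`AbelianContraction.lean`. Contents: `N_e(a^{(0)}) ≤ D/4`; support invariance (`a^{(k)}` vanishes off the boundary
lattice `Λ = ⟨χ_p⟩`); `CycleGirthFour ⇒ GirthAt 4 (a^{(k)})`; `GirthAt 1` for free; the two inductions.
Kernel-checked: 0 sorries, axioms {propext, Classical.choice, Quot.sound}. Cell `lqcd-flow`, unit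
`pub-lqcd-theory1-g3`, 2026-08-21.
-/

namespace Summit.Ventures.LatticeQCDFlow.TrivializingMaps.Abelian

open Finset

variable {E P : Type*} [Fintype E] [Fintype P]

noncomputable section

/-! ### The volume-uniform geometric bound (THEORY-1 §12.4, U(1)) -/

section Geometric

variable (K : PlaquetteComplex E P)

/-- Unfolding `a^{(0)}`. -/
theorem luscherCoeffs_zero :
    luscherCoeffs K 0 = ∑ p : P, (-(1 / 8 : ℝ)) • (Finsupp.single (K.χ p) 1 + Finsupp.single (-K.χ p) 1) := rfl

/-- Unfolding `a^{(k+1)} = stepR a^{(k)}`. -/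
theorem luscherCoeffs_succ (k : ℕ) : luscherCoeffs K (k + 1) = stepR K (luscherCoeffs K k) := rfl

/-- `N_e(a^{(0)}) ≤ D/4`: `a^{(0)} = -1/8` on `± χ_p`, at most `D` plaquettes through `e`. -/
theorem locNorm_luscherCoeffs_zero_le (e : E) : locNorm e (luscherCoeffs K 0) ≤ (K.D : ℝ) / 4 := by
  rw [luscherCoeffs_zero]
  have hterm : ∀ p, locNorm e ((-(1 / 8 : ℝ)) • (Finsupp.single (K.χ p) (1 : ℝ) + Finsupp.single (-K.χ p) 1))
      ≤ |(K.χ p e : ℝ)| / 4 := by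
    intro p
    rw [LocNorm.smul]
    calc |(-(1 / 8 : ℝ))| * locNorm e (Finsupp.single (K.χ p) (1 : ℝ) + Finsupp.single (-K.χ p) 1)
        ≤ |(-(1 / 8 : ℝ))| * (locNorm e (Finsupp.single (K.χ p) (1 : ℝ)) + locNorm e (Finsupp.single (-K.χ p) (1 : ℝ))) :=
          mul_le_mul_of_nonneg_left (LocNorm.add_le e _ _) (abs_nonneg _)
      _ = |(K.χ p e : ℝ)| / 4 := by
          have h8 : |(-(1 / 8 : ℝ))| = 1 / 8 := by rw [abs_neg, abs_of_pos (by norm_num)]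
          rw [h8, LocNorm.single, LocNorm.single]
          simp only [Pi.neg_apply, Int.cast_neg, abs_neg, abs_one, mul_one]
          ring
  calc locNorm e (∑ p : P, (-(1 / 8 : ℝ)) • (Finsupp.single (K.χ p) 1 + Finsupp.single (-K.χ p) 1))
      ≤ ∑ p : P, locNorm e ((-(1 / 8 : ℝ)) • (Finsupp.single (K.χ p) (1 : ℝ) + Finsupp.single (-K.χ p) 1)) :=
        LocNorm.finset_sum_le e _ _
    _ ≤ ∑ p : P, |(K.χ p e : ℝ)| / 4 := Finset.sum_le_sum fun p _ => hterm p
    _ = (∑ p : P, |(K.χ p e : ℝ)|) / 4 := by rw [Finset.sum_div]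
    _ ≤ (K.D : ℝ) / 4 := by gcongr; exact sum_abs_χ_le K e

/-- The boundary lattice `Λ = ⟨χ_p : p⟩ ⊆ ℤ^E`. -/
def boundaryLattice : AddSubgroup (Mode E) := AddSubgroup.closure (Set.range K.χ)

/-- Each `χ_p` lies in the boundary lattice. -/
theorem χ_mem_boundaryLattice (p : P) : K.χ p ∈ boundaryLattice K :=
  AddSubgroup.subset_closure (Set.mem_range_self p)

/-- Support invariance: every `a^{(k)}` vanishes off the boundary lattice. -/
theorem luscherCoeffs_apply_eq_zero (k : ℕ) :
    ∀ n : Mode E, n ∉ boundaryLattice K → luscherCoeffs K k n = 0 := by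
  classical
  induction k with
  | zero =>
    intro n hn
    rw [luscherCoeffs_zero, Finsupp.finsetSum_apply]
    refine Finset.sum_eq_zero fun p _ => ?_
    have h1 : K.χ p ≠ n := fun h => hn (h ▸ χ_mem_boundaryLattice K p)
    have h2 : -K.χ p ≠ n := fun h => hn (h ▸ (boundaryLattice K).neg_mem (χ_mem_boundaryLattice K p))
    simp [h1.symm, h2.symm]
  | succ k ih =>
    intro n hn
    rw [luscherCoeffs_succ, stepR, Finsupp.sum_apply]
    unfold Finsupp.sum
    refine Finset.sum_eq_zero fun m hm => ?_
    have hmS : m ∈ boundaryLattice K := by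
      by_contra h
      exact (Finsupp.mem_support_iff.mp hm) (ih m h)
    dsimp only
    rw [Finsupp.finsetSum_apply]
    refine Finset.sum_eq_zero fun p _ => ?_
    have h1 : m - K.χ p ≠ n := fun h =>
      hn (h ▸ (boundaryLattice K).sub_mem hmS (χ_mem_boundaryLattice K p))
    have h2 : m + K.χ p ≠ n := fun h =>
      hn (h ▸ (boundaryLattice K).add_mem hmS (χ_mem_boundaryLattice K p))
    simp [h1.symm, h2.symm]

/-- `supp a^{(k)} ⊆ Λ`. -/
theorem mem_boundaryLattice_of_mem_support (k : ℕ) {n : Mode E} (hn : n ∈ (luscherCoeffs K k).support) :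
    n ∈ boundaryLattice K := by
  by_contra h
  exact (Finsupp.mem_support_iff.mp hn) (luscherCoeffs_apply_eq_zero K k n h)

/-- Under the girth-4 property every `a^{(k)}` satisfies the girth hypothesis at level 4. -/
theorem girthAt_luscherCoeffs (h4 : CycleGirthFour K) (k : ℕ) : GirthAt K 4 (luscherCoeffs K k) := by
  intro n hn p m hm hm0
  have hnS := mem_boundaryLattice_of_mem_support K k hn
  have hmS : m ∈ boundaryLattice K := by
    rcases hm with rfl | rfl
    · exact (boundaryLattice K).add_mem hnS (χ_mem_boundaryLattice K p)
    · exact (boundaryLattice K).sub_mem hnS (χ_mem_boundaryLattice K p)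
  have := h4 m hmS hm0
  exact_mod_cast this

/-- **THEOREM (ours, gen-3): the volume-uniform geometric gradient bound — `N_e(a^{(k)}) ≤ (D/4)(3D)^k` for every
finite plaquette complex with the girth-4 property; on the torus `(ℤ/L)^d`, `L ≥ 4`: `|∂_e s_k| ≤ ((d-1)/2)(6(d-1))^k`
with NO dependence on `L` — the U(1) case of THEORY-1 Theorem A, kernel-checked.** -/
theorem abelianGeometricGradientBound : AbelianGeometricGradientBound K := by
  intro h4 k
  induction k with
  | zero =>
    intro e
    simpa using locNorm_luscherCoeffs_zero_le K e
  | succ k ih =>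
    intro e
    rw [luscherCoeffs_succ]
    have h := abelianStepContraction K 4 (by norm_num) (luscherCoeffs K k) ((K.D : ℝ) / 4 * (3 * K.D) ^ k)
      (girthAt_luscherCoeffs K h4 k) ih e
    calc locNorm e (stepR K (luscherCoeffs K k))
        ≤ (K.D : ℝ) * (1 + 8 / ((4 : ℕ) : ℝ)) * ((K.D : ℝ) / 4 * (3 * K.D) ^ k) := h
      _ = (K.D : ℝ) / 4 * (3 * K.D) ^ (k + 1) := by push_cast; ring

/-- The girth hypothesis at level `1` is free: every nonzero integer mode has `c(m) ≥ 1`. -/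
theorem girthAt_one (a : Coeffs E) : GirthAt K 1 a := by
  intro n _ p m _ hm0
  exact_mod_cast one_le_normSq hm0

/-- **Unconditional volume-uniform geometric gradient bound (U(1), ANY finite plaquette complex)** — OURS,
PROVED: `N_e(a^{(k)}) ≤ (D/4)(9D)^k` for all `k`, all links `e`, with NO girth hypothesis (take `g = 1` in the
one-step contraction: factor `D(1+8) = 9D`). On `(ℤ/L)^d` (`D = 2(d-1)`) this is a radius `tβ ≥ 1/(18(d-1))`
for the gradient series for EVERY `L ≥ 1`; the girth-4 refinement `abelianGeometricGradientBound` improves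
`9D` to `3D`. -/
theorem abelianGeometricGradientBound_one (k : ℕ) (e : E) :
    locNorm e (luscherCoeffs K k) ≤ (K.D : ℝ) / 4 * (9 * K.D) ^ k := by
  induction k generalizing e with
  | zero => simpa using locNorm_luscherCoeffs_zero_le K e
  | succ k ih =>
    rw [luscherCoeffs_succ]
    have h := abelianStepContraction K 1 le_rfl (luscherCoeffs K k) ((K.D : ℝ) / 4 * (9 * K.D) ^ k)
      (girthAt_one K _) ih e
    calc locNorm e (stepR K (luscherCoeffs K k))
        ≤ (K.D : ℝ) * (1 + 8 / ((1 : ℕ) : ℝ)) * ((K.D : ℝ) / 4 * (9 * K.D) ^ k) := h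
      _ = (K.D : ℝ) / 4 * (9 * K.D) ^ (k + 1) := by push_cast; ring

end Geometric

end

end Summit.Ventures.LatticeQCDFlow.TrivializingMaps.Abelian
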